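/-
Copyright (c) 2026 the pub-hodgecm-mathlib formalisation cell (harness21).  Prover seat hodgecm-mathlib-LH4-p07 (g9), req620 Track A «(D-RAM) FOUR-FRAME» squad
(STAGE-1b, row-(2) lineage; dealer LH4-plan (g13) WORD #58 RULING A ∕ #59: owner of the two-literal census law of `lev_{a,m}`), 2026-09-04.
-/
import Summits.HodgeConjecture.HodgeConjecture.Theorems.F0P3cDyRamToricCensusSumUnrReindex   -- ★ (LH4-p08 (g5)): `ncard_levelSetDep_eq_zero_of_succ_le`, row re-index; brings ★ `ncard_levelSetDep_zero` (R1-A0)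
import HarnessLib

/-!
# Crux `H413`, line LH4 «(D-RAM) FOUR-FRAME» — STAGE-1b, row (2): (T5-P-reindex) «THE CUT ORDER COUNTS RE-INDEXED INTO THE T5s DOUBLE SUM WITH THE CUTOFF INSIDE»
# `Σ_{j ≤ jλ} #levelSet(j,0) + Σ_{b ∈ Icc 1 R} Σ_{j ≤ jλ} [j + b ≤ C]·q^b·#levelSetDep(j,b;μ) = Σ_{j ≤ jλ} Σ_{a ≤ jλ+1} q^a·[j + a ≤ C]·#levelSetDep(j,a;μ)`,  `jλ ≤ C`  (M∕E unramified tokens)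

Cell `hodgecm-mathlib` (D-0151), FLOOR 0, crux item H413 = `stmt-HodgeConjecture-24833`, route of record `HCCMUnconditional`; squad F0∕P3c∕LH4; lane
`--supports stmt-HodgeConjecture-24833 --as helper` (count-neutral; pays NO tier-0 row).  THEOREMS ONLY (no `def`, no instance, no notation, no `sorry`, default heartbeats).
OWNER'S ORGAN №3 for the END `levels_typeTwo_censusLaw` (= `hLaw` of ★ p859606).

THE OBJECT.  ★ p859713 (T5-P-cut) delivers the `G`-side census of a template piece at one literal as «axis rows `j ≤ J′`» + «cone cells `(j,b)`, `b ≥ 1`, behind the diagonal cutoff»,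
with abstract weights that ★ (β′) (LH4-p11 (g7), in flight) sums to `q^b·#levelSetDep(j,b;μ₁)`; ★ `…ToricCensusSumRamKCut.toricCensusSum_ramK_cut` (this seat) and LH4-p08 (g8)'s type-U
twin consume the T5s DOUBLE SUM `Σ_{j ≤ jλ} Σ_{a ≤ jλ+1} q^a·[j + a ≤ C]·(vP − vM)` at the tokens `(m, jλ)` OF THE MULTIPLIER.  THIS FILE is the bridge between the two shapes — the
cut twin of ★ `orderCounts_eq_censusSum_unr_of_cells` (LH4-p08 (g5)), type-free on the M∕E-unramified token set (`|α − ρα| = 1`, `|ϖE| = exp(−1)`: types U and RamK), ONE scalar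
`h`, ANY multiplier `μ` with `|μ| = exp(−m)`, `|μ − ρμ| = exp(−jλ)`:
* §1 `ncard_levelSet_zero_add_sum_Icc_cut_eq_sum_range` — ONE ROW `j ≤ jλ ≤ C`: `#levelSet(j,0) + Σ_{b ∈ Icc 1 R} [j + b ≤ C]·q^b·#levelSetDep(j,b;μ) =
  Σ_{a ∈ range (jλ+2)} q^a·[j + a ≤ C]·#levelSetDep(j,a;μ)` for `R ≥ jλ + 1` (the `a = 0` cell passes the cutoff since `j ≤ jλ ≤ C` and the depth test by ★ (R1-A0); the cells
  `a ≥ j + 1` are empty, ★ `ncard_levelSetDep_eq_zero_of_succ_le`);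
* §2 `cutOrderCounts_eq_cutCensusSum_of_cells` — THE WHOLE SIDE with the tube bound read on cells (`hRcells`, as in ★ `…_of_cells`):
  `Σ_{j<jλ+1} #levelSet(j,0) + Σ_{b ∈ Icc 1 R} Σ_{j<jλ+1} (if j + b ≤ C then q^b·#levelSetDep(j,b;μ) else 0) = Σ_{j<jλ+1} Σ_{a<jλ+2} q^a·(if j + a ≤ C then #levelSetDep(j,a;μ) else 0)`;
* §3 `sub_eq_sum_ite_sub` — the two sides' difference in the consumer's shape `Σ_j Σ_a q^a·(if j + a ≤ C then vP j a − vM j a else 0)`.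
For the pieces of record the rows come from ★ p859713 as `range (J′+1)` with `J′ = min(jl − a′, jl + n − b′) = jl − a′ = jλ(μ₁)` near `1`, and the cutoff `j + b + nν ≤ m₂ + jl` as
`j + b ≤ C`, `C := m₂ + jl − nν` (§0 `add_le_iff_le_sub_of_le`).  The RamM twin (half-unit tokens, ★ `…RamMReindex`) is a separate organ.
HONEST LABEL.  Count-neutral bookkeeping over ★ organs; nothing printed is asserted; no census law is stated; `HC_CM` is proved only modulo the 7 printed citations (2 remaining named inputs:
hLiu418 = `stmt-HodgeConjecture-24832`, h413 = `stmt-HodgeConjecture-24833`) until rung 0 closes.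

## References
* [Kottwitz1986BaseChangeUnits] R. E. Kottwitz, *Base change for unit elements of Hecke algebras*, Compositio Math. 60 (1986): §1 pp. 240–241.
* [Rogawski1990] J. D. Rogawski, *Automorphic Representations of Unitary Groups in Three Variables*, Ann. of Math. Stud. 123 (1990): §4.9 Prop. 4.9.1 (b) p. 55, Lemma 4.9.3 p. 56.
* [Jacobowitz1962] R. Jacobowitz, *Hermitian forms over local fields*, Amer. J. Math. 84 (1962): §4.
-/

set_option autoImplicit false

open WithZero IsLocalRing Finset
open scoped Valued Classical

namespace Summit.HodgeConjecture.HodgeConjecture.Cruxes.H413.F0P3cDyRamToricCensusSumCutReindex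

open Summit.HodgeConjecture.HodgeConjecture.Cruxes.H413.F0P3cDyRamToricCensusDefs
open Summit.HodgeConjecture.HodgeConjecture.Cruxes.H413.F0P3cDyRamToricLevelCensusUnr
  (ncard_levelSetDep_zero ncard_levelSetDep_eq_zero_of_succ_le)

/-! ## §0 The cutoff letter of ★ p859713 as `j + b ≤ C` -/

/-- `j + b + n ≤ M ⟺ j + b ≤ M − n` once `n ≤ M` (the cutoff of ★ p859713 `…_orderForm_cutoff` with `C := m₂ + jl − nν`). -/
theorem add_le_iff_le_sub_of_le {n M : ℕ} (h : n ≤ M) (j b : ℕ) : j + b + n ≤ M ↔ j + b ≤ M - n := by omega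

variable {K : Type*} [Field K] [Valued K ℤᵐ⁰] {ρ Θ : K →+* K} {α ϖE h : K}

/-! ## §1 One row -/

/-- **ONE ROW, WITH THE CUTOFF** (`j ≤ jλ ≤ C`, `R ≥ jλ + 1`): `#levelSet(j,0) + Σ_{b ∈ Icc 1 R} [j + b ≤ C]·q^b·#levelSetDep(j,b;μ) = Σ_{a<jλ+2} q^a·[j + a ≤ C]·#levelSetDep(j,a;μ)` —
the `a = 0` cell is uncut and passes the depth test (★ (R1-A0)), the cells `a ≥ j + 1` are empty. [cite: Kottwitz1986BaseChangeUnits, §1 pp. 240–241] [cite: Jacobowitz1962, §4] -/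
theorem ncard_levelSet_zero_add_sum_Icc_cut_eq_sum_range (hρρ : ∀ x, ρ (ρ x) = x) (hvρ : ∀ x, Valued.v (ρ x) = Valued.v x) (hΘΘ : ∀ x, Θ (Θ x) = x)
    (hΘρ : ∀ x, Θ (ρ x) = ρ (Θ x)) (hvΘ : ∀ x, Valued.v (Θ x) = Valued.v x) (hα1 : Valued.v α ≤ 1) (hα : Valued.v (α - ρ α) = 1)
    (hρϖE : ρ ϖE = ϖE) (hϖE : Valued.v ϖE = exp (-1 : ℤ)) (hh : h ≠ 0)
    {μ : K} {m jl : ℕ} (hm : Valued.v μ = exp (-(m : ℤ))) (hjl : Valued.v (μ - ρ μ) = exp (-(jl : ℤ))) (q : ℕ)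
    {j : ℕ} (hj : j ≤ jl) {R : ℕ} (hR : jl + 1 ≤ R) {C : ℕ} (hC : jl ≤ C) :
    (levelSet ρ Θ α ϖE h j 0).ncard + ∑ b ∈ Icc 1 R, (if j + b ≤ C then q ^ b * (levelSetDep ρ Θ α ϖE h j b μ).ncard else 0) =
      ∑ a ∈ range (jl + 2), q ^ a * (if j + a ≤ C then (levelSetDep ρ Θ α ϖE h j a μ).ncard else 0) := by
  set f : ℕ → ℕ := fun a => q ^ a * (if j + a ≤ C then (levelSetDep ρ Θ α ϖE h j a μ).ncard else 0) with hf
  have hf0 : ∀ a, jl + 2 ≤ a → f a = 0 := fun a ha => by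
    rw [hf]; dsimp only
    rw [ncard_levelSetDep_eq_zero_of_succ_le (Θ := Θ) hvρ hα hϖE h μ (by omega : j + 1 ≤ a), ite_self, mul_zero]
  have hfb : ∀ b, (if j + b ≤ C then q ^ b * (levelSetDep ρ Θ α ϖE h j b μ).ncard else 0) = f b := fun b => by
    rw [hf]; dsimp only
    split_ifs <;> simp
  have hL : (levelSet ρ Θ α ϖE h j 0).ncard + ∑ b ∈ Icc 1 R, f b = ∑ a ∈ range (R + 1), f a := by
    rw [sum_range_succ', ← Finset.Ico_add_one_right_eq_Icc, sum_Ico_eq_sum_range, add_comm]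
    congr 1
    · refine sum_congr (by rw [Nat.add_sub_cancel]) fun k _ => by rw [add_comm]
    · rw [hf]; dsimp only
      rw [pow_zero, one_mul, if_pos (by omega), ncard_levelSetDep_zero hρρ hvρ hΘΘ hΘρ hvΘ hα1 hα hρϖE hϖE hh hm hjl hj]
  have hRHS : ∑ a ∈ range (jl + 2), f a = ∑ a ∈ range (R + 1), f a :=
    sum_subset (range_subset_range.2 (by omega)) fun a _ hna => hf0 a (by rw [mem_range, not_lt] at hna; omega)
  rw [Finset.sum_congr rfl fun b _ => hfb b, hL, hRHS]

/-! ## §2 The whole side, tube bound on cells -/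

/-- **THE CUT ORDER COUNTS RE-INDEXED, CELL-BOUND FORM** (one scalar `h`, any multiplier `μ` with tokens `(m, jλ)`, `jλ ≤ C`; `hRcells`: the non-empty cone cells of the rows
`j ≤ jλ` have `b ≤ R`): `Σ_{j<jλ+1} #levelSet(j,0) + Σ_{b ∈ Icc 1 R} Σ_{j<jλ+1} (if j + b ≤ C then q^b·#levelSetDep(j,b;μ) else 0) = Σ_{j<jλ+1} Σ_{a<jλ+2} q^a·(if j + a ≤ C then
#levelSetDep(j,a;μ) else 0)` — the cut twin of ★ `orderCounts_eq_censusSum_unr_of_cells`. [cite: Kottwitz1986BaseChangeUnits, §1 pp. 240–241] [cite: Rogawski1990, §4.9 Prop. 4.9.1 (b) p. 55, Lemma 4.9.3 p. 56] -/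
theorem cutOrderCounts_eq_cutCensusSum_of_cells (hρρ : ∀ x, ρ (ρ x) = x) (hvρ : ∀ x, Valued.v (ρ x) = Valued.v x) (hΘΘ : ∀ x, Θ (Θ x) = x)
    (hΘρ : ∀ x, Θ (ρ x) = ρ (Θ x)) (hvΘ : ∀ x, Valued.v (Θ x) = Valued.v x) (hα1 : Valued.v α ≤ 1) (hα : Valued.v (α - ρ α) = 1)
    (hρϖE : ρ ϖE = ϖE) (hϖE : Valued.v ϖE = exp (-1 : ℤ)) (hh : h ≠ 0)
    {μ : K} {m jl : ℕ} (hm : Valued.v μ = exp (-(m : ℤ))) (hjl : Valued.v (μ - ρ μ) = exp (-(jl : ℤ))) (q : ℕ)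
    {lam : K} (hiff : ∀ j, IsOrd ρ α (ϖE ^ j) lam ↔ j ≤ jl) {C : ℕ} (hC : jl ≤ C) {R : ℕ}
    (hRcells : ∀ j b, 1 ≤ b → IsOrd ρ α (ϖE ^ j) lam → (levelSetDep ρ Θ α ϖE h j b μ).Nonempty → b ≤ R) :
    (∑ j ∈ range (jl + 1), (levelSet ρ Θ α ϖE h j 0).ncard) +
        ∑ b ∈ Icc 1 R, ∑ j ∈ range (jl + 1), (if j + b ≤ C then q ^ b * (levelSetDep ρ Θ α ϖE h j b μ).ncard else 0) =
      ∑ j ∈ range (jl + 1), ∑ a ∈ range (jl + 2), q ^ a * (if j + a ≤ C then (levelSetDep ρ Θ α ϖE h j a μ).ncard else 0) := by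
  rw [sum_comm, ← sum_add_distrib]
  refine sum_congr rfl fun j hj' => ?_
  have hj : j ≤ jl := by rw [mem_range] at hj'; omega
  -- the cells `b > R` of this row are empty: extend the sum to `Icc 1 (max R (jl + 1))`
  have hext : ∑ b ∈ Icc 1 R, (if j + b ≤ C then q ^ b * (levelSetDep ρ Θ α ϖE h j b μ).ncard else 0) =
      ∑ b ∈ Icc 1 (max R (jl + 1)), (if j + b ≤ C then q ^ b * (levelSetDep ρ Θ α ϖE h j b μ).ncard else 0) := by
    refine sum_subset (Icc_subset_Icc_right (le_max_left _ _)) fun b hb hnb => ?_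
    rw [mem_Icc] at hb hnb
    have hempty : levelSetDep ρ Θ α ϖE h j b μ = ∅ :=
      Set.not_nonempty_iff_eq_empty.1 fun hne => hnb ⟨hb.1, hRcells j b hb.1 ((hiff j).2 hj) hne⟩
    rw [hempty, Set.ncard_empty, mul_zero, ite_self]
  rw [hext]
  exact ncard_levelSet_zero_add_sum_Icc_cut_eq_sum_range hρρ hvρ hΘΘ hΘρ hvΘ hα1 hα hρϖE hϖE hh hm hjl q hj (le_max_right _ _) hC

/-! ## §3 The difference of the two literals in the weld's shape -/

/-- The two re-indexed sides subtract into the cut weld's summand (cast to any commutative ring): `Σ_jΣ_a x^a·[cut]·vP − Σ_jΣ_a x^a·[cut]·vM = Σ_jΣ_a x^a·(if cut then vP − vM else 0)`.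
[cite: Kottwitz1986BaseChangeUnits, §1 pp. 240–241] -/
theorem sub_eq_sum_ite_sub {S : Type*} [CommRing S] (x : S) (vP vM : ℕ → ℕ → S) (J A C : ℕ) :
    ∑ j ∈ range J, ∑ a ∈ range A, x ^ a * (if j + a ≤ C then vP j a else 0) - ∑ j ∈ range J, ∑ a ∈ range A, x ^ a * (if j + a ≤ C then vM j a else 0) =
      ∑ j ∈ range J, ∑ a ∈ range A, x ^ a * (if j + a ≤ C then vP j a - vM j a else 0) := by
  rw [← sum_sub_distrib]
  refine sum_congr rfl fun j _ => ?_
  rw [← sum_sub_distrib]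
  refine sum_congr rfl fun a _ => ?_
  split_ifs <;> ring

end Summit.HodgeConjecture.HodgeConjecture.Cruxes.H413.F0P3cDyRamToricCensusSumCutReindex
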